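import Summits.HodgeConjecture.HodgeConjecture.Theorems.CurveNetMordellWeilLefschetzOneOneKodairaSerre
import Literature.AlgebraicGeometry.HodgeTheory.KodairaSerreSectionsAllDim

/-!
# Route CurveNetMordellWeil — support item `LefschetzOneOne` (stmt-HodgeConjecture-8544): the close

The route item `Summit.HodgeConjecture.HodgeConjecture.Theses.CurveNetMordellWeil.LefschetzOneOne`
(Lefschetz's theorem on `(1,1)`-classes, rational form — the `q = 1` base of the induction on
codimension in the deciding theorem `closes`; verbatim the Literature named fact
`lefschetzOneOne_rational`, `lefschetzOneOne_iff_lefschetzOneOne_rational`) is PROVED: the tree reduced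
it to the Kodaira–Serre sections (`lefschetzOneOne_of_kodairaSerreSections`,
`Theorems/CurveNetMordellWeilLefschetzOneOneKodairaSerre`: Voisin's proof of Thm. 11.30 / Cor. 11.34 —
Čech integrality, the Weil–Kostant heart, rigidity of de Rham comparisons, Chow, universal
coefficients, the meromorphic section `σ/s^an` — all proved in `Literature/`), and those are now a
theorem in all dimensions, `Literature.AlgebraicGeometry.HodgeTheory.kodairaSerre_exists_globalSection_algebraicTwist_holds`
(`Literature/AlgebraicGeometry/HodgeTheory/KodairaSerreSectionsAllDim`: Serre's dimension count over a
transverse flag of hyperplane sections, GAGA n° 16 Lemme 8 / FAC n° 81, with the Cartan–Serre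
finiteness of the twisted Čech cohomology). The close is the recorded one-liner.
-/

noncomputable section

-- Single-problem summit: the namespace `Summit.HodgeConjecture.HodgeConjecture.…` repeats the summit name
-- by design (D-0017); the lakefile turns `linter.dupNamespace` off for the `Summits` library, repeated
-- here so that stand-alone elaboration of this file is warning-free too.
set_option linter.dupNamespace false

namespace Summit.HodgeConjecture.HodgeConjecture.Theorems

/-- **Lefschetz `(1,1)` for the route (item `LefschetzOneOne`, PROVED)**: for `X` smooth projective of
dimension `n` over `ℂ`, every rational class of Hodge type `(1,1)` in `H²(X(ℂ); ℂ)` lies in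
`algebraicClasses X 1` — from the Kodaira–Serre sections, now the theorem
`kodairaSerre_exists_globalSection_algebraicTwist_holds`, through the recorded one-liner
`lefschetzOneOne_of_kodairaSerreSections`. [cite: VoisinHodgeI2002, Thm. 11.30, Cor. 11.34 and §11.3.3]
[cite: SerreGAGA1956, n°16 Lemme 8] -/
theorem lefschetzOneOne_proof :
    Summit.HodgeConjecture.HodgeConjecture.Theses.CurveNetMordellWeil.LefschetzOneOne :=
  lefschetzOneOne_of_kodairaSerreSections
    Literature.AlgebraicGeometry.HodgeTheory.kodairaSerre_exists_globalSection_algebraicTwist_holds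

end Summit.HodgeConjecture.HodgeConjecture.Theorems

end
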